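import Literature.NumberTheory.Transcendental.KZRulesAssociator
import Literature.NumberTheory.Transcendental.KZCubicalCalculus
import Literature.NumberTheory.Transcendental.KZLogCalculusProofs
import Summits.KontsevichZagierPeriods.KontsevichZagierPeriods.Theses.FurushoPentagon

/-!
# `PentagonInKZ`, line `edge-normal-newton-leibniz`: corner engine — representations on cubes

Bookkeeping of the corner engine (proof of `cornerEngine_uniformlyNull` of the crux
`FurushoPentagon.PentagonInKZ`, stmt-KontsevichZagierPeriods-11348).  Every integral representation of
the engine lives on a closed unit cube `KZ.cube d`; this file provides

* `CornerReps.exists_rep_cube` — a bounded `ℚ`-semialgebraic function on `[0,1]ᵈ` is the integrand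
  of a representation with domain the cube (integrable: bounded and a.e.-measurable on a set of
  finite measure);
* the class `⟦r⟧ = toPeriodAlgebra (toFormalPeriod [r]) ∈ P_ℚ` and its calculus on cubes:
  `cls_eq_zero_of_eqOn_zero` (zero integrand), `cls_congr` (equal integrands), `cls_add` /
  `cls_sub` (integrand additivity), `cls_reindex` (coordinate permutations, rule (2)),
  `cls_newtonLeibniz_cube` (rule (3) along the LAST coordinate of the cube with the constant bounds
  `0 ≤ t ≤ 1`: `⟦[0,1]ᵈ⁺¹, ∂ₜG⟧ = ⟦[0,1]ᵈ, G(·,1) − G(·,0)⟧`).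

References: [KontsevichZagier2001, §1.2 rules (1)–(3)].
-/

noncomputable section

open Set MeasureTheory
open Literature.NumberTheory.Transcendental
open Literature.ModelTheory.ExponentialFields (IsSemialgebraic)

namespace Summit.KontsevichZagierPeriods.FurushoPentagon.PentagonInKZ

namespace CornerReps

variable {d : ℕ}

/-! ### Representations on the cube -/

/-- **A bounded semialgebraic function on the closed unit cube is the integrand of a
representation** (domain the cube): it is a.e.-strongly measurable (semialgebraic functions are
Borel measurable) and bounded on a set of measure `1`. [cite: KontsevichZagier2001, §1.1] -/
theorem exists_rep_cube (g : (Fin d → ℝ) → ℝ) (hg : IsSemialgebraicFunOn ℚ (KZ.cube d) g)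
    (hb : ∃ C : ℝ, ∀ z ∈ KZ.cube d, |g z| ≤ C) :
    ∃ r : KZ.IntegralRep d, r.domain = KZ.cube d ∧ r.integrand = g := by
  obtain ⟨C, hC⟩ := hb
  refine ⟨⟨KZ.cube d, g, KZ.isSemialgebraic_cube, hg, ?_⟩, rfl, rfl⟩
  have hvol : volume (KZ.cube d) ≠ ⊤ := by
    rw [KZ.cube_eq_Icc]; exact measure_Icc_lt_top.ne
  refine ⟨KZ.aestronglyMeasurable_of_isSemialgebraicFunOn hg KZ.measurableSet_cube,
    HasFiniteIntegral.restrict_of_bounded (C := C) hvol.lt_top ?_⟩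
  exact (ae_restrict_mem KZ.measurableSet_cube).mono fun z hz => by
    rw [Real.norm_eq_abs]; exact hC z hz

/-! ### The class in `P_ℚ` and its calculus -/

/-- A representation whose integrand vanishes on its domain has class `0`.
[cite: KontsevichZagier2001, §1.2 rule (1)] -/
theorem cls_eq_zero_of_eqOn_zero (r : KZ.IntegralRep d) (h : EqOn r.integrand 0 r.domain) :
    KZ.toPeriodAlgebra (KZ.toFormalPeriod (KZ.of r)) = 0 := by
  rw [KZ.toFormalPeriod_eq_zero_of_mem (KZ.of_mem_relations_of_eqOn_zero r h), map_zero]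

/-- Representations with the same domain and integrands agreeing on it have the same class.
[cite: KontsevichZagier2001, §1.2 rule (1)] -/
theorem cls_congr {r r' : KZ.IntegralRep d} (hd : r'.domain = r.domain)
    (h : EqOn r.integrand r'.integrand r.domain) :
    KZ.toPeriodAlgebra (KZ.toFormalPeriod (KZ.of r)) = KZ.toPeriodAlgebra (KZ.toFormalPeriod (KZ.of r')) := by
  have hrel := KZ.of_sub_of_mem_relations_of_eqOn hd h
  have : KZ.toFormalPeriod (KZ.of r) = KZ.toFormalPeriod (KZ.of r') := by
    rwa [KZ.toFormalPeriod_eq_iff]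
  rw [this]

/-- **Integrand additivity**: `⟦σ, g₁ + g₂⟧ = ⟦σ, g₁⟧ + ⟦σ, g₂⟧` for three representations on the
same domain. [cite: KontsevichZagier2001, §1.2 rule (1)] -/
theorem cls_add {r r₁ r₂ : KZ.IntegralRep d} (h₁ : r₁.domain = r.domain) (h₂ : r₂.domain = r.domain)
    (h : EqOn r.integrand (r₁.integrand + r₂.integrand) r.domain) :
    KZ.toPeriodAlgebra (KZ.toFormalPeriod (KZ.of r)) =
      KZ.toPeriodAlgebra (KZ.toFormalPeriod (KZ.of r₁)) + KZ.toPeriodAlgebra (KZ.toFormalPeriod (KZ.of r₂)) := by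
  have hrel : KZ.of r - KZ.of r₁ - KZ.of r₂ ∈ KZ.relations :=
    KZ.integrandAddRel_subset_relations ⟨d, r, r₁, r₂, h₁, h₂, h, rfl⟩
  have h0 := KZ.toFormalPeriod_eq_zero_of_mem hrel
  rw [map_sub, map_sub, sub_sub, sub_eq_zero] at h0
  rw [h0, map_add]

/-- Integrand additivity, difference form: `⟦σ, g₁ - g₂⟧ = ⟦σ, g₁⟧ - ⟦σ, g₂⟧`.
[cite: KontsevichZagier2001, §1.2 rule (1)] -/
theorem cls_sub {r r₁ r₂ : KZ.IntegralRep d} (h₁ : r₁.domain = r.domain) (h₂ : r₂.domain = r.domain)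
    (h : EqOn r.integrand (r₁.integrand - r₂.integrand) r.domain) :
    KZ.toPeriodAlgebra (KZ.toFormalPeriod (KZ.of r)) =
      KZ.toPeriodAlgebra (KZ.toFormalPeriod (KZ.of r₁)) - KZ.toPeriodAlgebra (KZ.toFormalPeriod (KZ.of r₂)) := by
  -- `r₁ = r + r₂` on the common domain
  have h' : EqOn r₁.integrand (r.integrand + r₂.integrand) r₁.domain := by
    intro z hz
    rw [h₁] at hz
    simp only [Pi.add_apply, h hz, Pi.sub_apply, sub_add_cancel]
  rw [cls_add (r := r₁) (r₁ := r) (r₂ := r₂) h₁.symm (h₂.trans h₁.symm) h', add_sub_cancel_right]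

/-- **Coordinate permutations** (rule (2) along a permutation matrix, `|det| = 1`):
`⟦r.reindex e⟧ = ⟦r⟧`. [cite: KontsevichZagier2001, §1.2 rule (2)] -/
theorem cls_reindex {k : ℕ} (r : KZ.IntegralRep d) (e : Fin d ≃ Fin k) :
    KZ.toPeriodAlgebra (KZ.toFormalPeriod (KZ.of (r.reindex e))) =
      KZ.toPeriodAlgebra (KZ.toFormalPeriod (KZ.of r)) := by
  have h0 := KZ.toFormalPeriod_eq_zero_of_mem (KZ.of_sub_of_reindex_mem_relations r e)
  rw [map_sub, sub_eq_zero] at h0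
  rw [h0]

/-- The cube is stable under coordinate permutations: the domain of `r.reindex e` is again the
cube when `r.domain` is. [folklore] -/
theorem reindex_domain_cube {k : ℕ} (r : KZ.IntegralRep d) (e : Fin d ≃ Fin k)
    (hr : r.domain = KZ.cube d) : (r.reindex e).domain = KZ.cube k := by
  ext w
  change (fun i => w (e i)) ∈ r.domain ↔ w ∈ KZ.cube k
  rw [hr, KZ.mem_cube, KZ.mem_cube]
  constructor
  · intro h j; simpa using h (e.symm j)
  · intro h i; exact h (e i)

/-- The integrand of `r.reindex e` (definitional). [folklore] -/
theorem reindex_integrand {k : ℕ} (r : KZ.IntegralRep d) (e : Fin d ≃ Fin k) (w : Fin k → ℝ) :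
    (r.reindex e).integrand w = r.integrand (fun i => w (e i)) := rfl

/-- **Newton–Leibniz along the last coordinate of the cube** (rule (3) with the constant bounds
`0 ≤ t ≤ 1`): if `G` is `ℚ`-semialgebraic on `[0,1]ᵈ⁺¹`, continuous in `t` on every closed fibre
and differentiable on the open fibre with derivative the integrand `W` of the band representation
`r` (domain `[0,1]ᵈ⁺¹`), and the base representation `r'` (domain `[0,1]ᵈ`) has integrand
`G(x,1) − G(x,0)`, then `⟦r⟧ = ⟦r'⟧`. [cite: KontsevichZagier2001, §1.2 rule (3)] -/
theorem cls_newtonLeibniz_cube (r : KZ.IntegralRep (d + 1)) (r' : KZ.IntegralRep d)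
    (G : (Fin (d + 1) → ℝ) → ℝ) (hr : r.domain = KZ.cube (d + 1)) (hr' : r'.domain = KZ.cube d)
    (hG : IsSemialgebraicFunOn ℚ (KZ.cube (d + 1)) G)
    (hcont : ∀ x ∈ KZ.cube d, ContinuousOn (fun t : ℝ => G (Fin.snoc x t)) (Icc 0 1))
    (hderiv : ∀ x ∈ KZ.cube d, ∀ t ∈ Ioo (0 : ℝ) 1,
      HasDerivAt (fun s : ℝ => G (Fin.snoc x s)) (r.integrand (Fin.snoc x t)) t)
    (hbase : ∀ x ∈ KZ.cube d, r'.integrand x = G (Fin.snoc x 1) - G (Fin.snoc x 0)) :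
    KZ.toPeriodAlgebra (KZ.toFormalPeriod (KZ.of r)) = KZ.toPeriodAlgebra (KZ.toFormalPeriod (KZ.of r')) := by
  have hrel : KZ.of r - KZ.of r' ∈ KZ.relations := by
    refine KZ.newtonLeibnizRel_subset_relations ⟨d, r, r', fun _ => 0, fun _ => 1, G, ?_, ?_, ?_,
      ?_, ?_, ?_, ?_, ?_, rfl⟩
    · rwa [hr]
    · rw [hr']
      exact (isSemialgebraicFunOn_aeval KZ.isSemialgebraic_cube (0 : MvPolynomial (Fin d) ℚ)).congr
        fun y _ => by simp
    · rw [hr']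
      exact (isSemialgebraicFunOn_aeval KZ.isSemialgebraic_cube (1 : MvPolynomial (Fin d) ℚ)).congr
        fun y _ => by simp
    · intro _ _; exact zero_le_one
    · rw [hr, hr', KZ.cube_succ_eq]
    · intro x hx; rw [hr'] at hx; exact hcont x hx
    · intro x hx; rw [hr'] at hx; exact hderiv x hx
    · intro x hx; rw [hr'] at hx; exact hbase x hx
  have h0 := KZ.toFormalPeriod_eq_zero_of_mem hrel
  rw [map_sub, sub_eq_zero] at h0
  rw [h0]

/-- A finite sum of classes of representations with zero integrands vanishes. [folklore] -/
theorem sum_cls_eq_zero {ι : Type*} (s : Finset ι) (dim : ι → ℕ) (R : (i : ι) → KZ.IntegralRep (dim i))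
    (h : ∀ i ∈ s, EqOn (R i).integrand 0 (R i).domain) :
    ∑ i ∈ s, KZ.toPeriodAlgebra (KZ.toFormalPeriod (KZ.of (R i))) = 0 :=
  Finset.sum_eq_zero fun i hi => cls_eq_zero_of_eqOn_zero (R i) (h i hi)

end CornerReps

/-- **Hook `cornerReps_newtonLeibniz_cube`** (registered form of `CornerReps.cls_newtonLeibniz_cube`):
rule (3) along the last coordinate of a closed unit cube, at the level of classes in `P_ℚ`.
[cite: KontsevichZagier2001, §1.2 rule (3)] -/
theorem cornerReps_newtonLeibniz_cube : ∀ (d : ℕ) (r : KZ.IntegralRep (d + 1)) (r' : KZ.IntegralRep d) (G : (Fin (d + 1) → ℝ) → ℝ), r.domain = KZ.cube (d + 1) → r'.domain = KZ.cube d → IsSemialgebraicFunOn ℚ (KZ.cube (d + 1)) G → (∀ x ∈ KZ.cube d, ContinuousOn (fun t : ℝ => G (Fin.snoc x t)) (Set.Icc 0 1)) → (∀ x ∈ KZ.cube d, ∀ t ∈ Set.Ioo (0 : ℝ) 1, HasDerivAt (fun s : ℝ => G (Fin.snoc x s)) (r.integrand (Fin.snoc x t)) t) → (∀ x ∈ KZ.cube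 d, r'.integrand x = G (Fin.snoc x 1) - G (Fin.snoc x 0)) → KZ.toPeriodAlgebra (KZ.toFormalPeriod (KZ.of r)) = KZ.toPeriodAlgebra (KZ.toFormalPeriod (KZ.of r')) :=
  fun _ r r' G hr hr' hG hcont hderiv hbase => CornerReps.cls_newtonLeibniz_cube r r' G hr hr' hG hcont hderiv hbase

end Summit.KontsevichZagierPeriods.FurushoPentagon.PentagonInKZ
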